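import Summits.BirchSwinnertonDyer.BirchSwinnertonDyer.Theorems.PrintCf2RamifiedOffTYZQFormPinned
import HarnessLib

/-!
# Route `PrintCf2`, crux stmt-BirchSwinnertonDyer-20509 `RamifiedOffTYZOfFacts` — the Q-form identity (★): THE KEY TWO-BLOCK LEMMA (F3)
# (cell `bsd-print-cf2`, LEAD of 20509 g6, line `offtyz-v7`, cycle 7; kernel helpers `--supports stmt-BirchSwinnertonDyer-20509`)

Fourth file of the kernel proof of g5's conjecture (★) `Q_n = q(κ_n)` (crux workfile `Cruxes/RamifiedOffTYZOfFacts/Lines/offtyz_v7_QFormProof.md`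
§6). Abstract arc weights under the reciprocity law; `q_x = qwt a x`, `κ_t = treeDet`, `D = setExp (qwt a y)`.

* `stageA_eq_zero` — for a block `R` and scalars with `zT₁ + zT₂ + Σ_R z = 1`:
  `(zT₁+1)·zT₂·Σ_{R₁ ⊆ R, yT + Σ_{R₁} y = 0} (zT₁ + Σ_{R₁} z) D(R₁) D(R∖R₁) = 0` (reciprocity lemma `D(R′) = (Σ_{R′} y) q_y(R′)`,
  convolution `Σ D D = [R = ∅]`, doubling identity `Σ (Σ_{R₁} z) D D = (Σ_R z) q_y(R)`).
* `key_two_block_sum_eq_zero` — **(KL)**: for `W = {s,t} ⊔ W₀` with `Σ_W y = 0`, `Σ_W z = 1`: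
  `Σ_{X ⊔ Y = W, s ∈ X, t ∈ Y, Σ_X y = 0, Σ_X z = 1} q_{z+e_s}(X) · q_z(Y) = 0` — both factors are pinned all-minors expansions
  (`pinned_expansion_eq`); regrouping by the two trees leaves Stage A. This is the identity behind the `x_s x_t`-coefficients of (★)
  (note §4: (★a) ⟺ Ψ_st = 0, and Ψ_st is a `det N`-weighted sum of these two-block sums).
Pure linear algebra over `𝔽₂`; no `sorry`. BSD is not proved by any of this; no class is closed.

References: [cite: Smith2016CongruentDensity, §2.2 case 5(b)]; [cite: Chaiken1982, §2]; [cite: Stanley1999EC2, Cor. 5.1.6].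
-/

namespace Summit.BirchSwinnertonDyer.PrintCf2.QFormForest

open Matrix Finset Literature.LinearAlgebra.Matrix Literature.Combinatorics.Enumerative
open Literature.NumberTheory.EllipticCurves.Smith2016

variable {V : Type*} [Fintype V] [LinearOrder V]


/-- **Stage A of the key lemma** (note §6, cases (a)/(b)/(b′)): for a block `R` under the reciprocity law and scalars `yT, zT₁, zT₂`
with `zT₁ + zT₂ + Σ_R z = 1`, the `R₁`-sum of the regrouped two-block convolution vanishes after the prefactor `(zT₁ + 1)·zT₂`:
`(zT₁+1) zT₂ · Σ_{R₁ ⊆ R, yT + Σ_{R₁} y = 0} (zT₁ + Σ_{R₁} z) D(R₁) D(R∖R₁) = 0`, `D = setExp(q_y)` (reciprocity lemma + doubling identity).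
[cite: Smith2016CongruentDensity, §2.2 case 5(b)] [cite: Stanley1999EC2, Cor. 5.1.6] -/
theorem stageA_eq_zero (a : V → V → ZMod 2) (y z : V → ZMod 2) {R : Finset V}
    (hrec : ∀ i ∈ R, ∀ j ∈ R, i ≠ j → a i j + a j i = y i * y j) (yT zT₁ zT₂ : ZMod 2)
    (hz : zT₁ + zT₂ + ∑ i ∈ R, z i = 1) :
    (zT₁ + 1) * zT₂ * ∑ R₁ ∈ R.powerset, (if yT + ∑ i ∈ R₁, y i = 0 then
      (zT₁ + ∑ i ∈ R₁, z i) * (setExp (qwt a y) R₁ * setExp (qwt a y) (R \ R₁)) else 0) = 0 := by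
  have h2 : (2 : ZMod 2) = 0 := by decide
  -- the unrestricted sums: convolution `Σ D D = [R = ∅]` and doubling `Σ z_{R₁} D D = z_R q_y(R)`
  have hconv : ∑ R₁ ∈ R.powerset, setExp (qwt a y) R₁ * setExp (qwt a y) (R \ R₁) = if R = ∅ then 1 else 0 := by
    rw [← setExp_add_self h2 (qwt a y) R, setExp_add]
  have hdoub := sum_powerset_pointed_setExp_mul_setExp h2 z (qwt a y) R
  obtain hyT | hyT : yT = 0 ∨ yT = 1 := by revert yT; decide
  · -- (a): only `R₁ = ∅` survives (an even nonempty block has `D = 0`)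
    subst hyT
    have hsum : ∑ R₁ ∈ R.powerset, (if 0 + ∑ i ∈ R₁, y i = 0 then
        (zT₁ + ∑ i ∈ R₁, z i) * (setExp (qwt a y) R₁ * setExp (qwt a y) (R \ R₁)) else 0) =
        zT₁ * setExp (qwt a y) R := by
      rw [sum_eq_single_of_mem ∅ (empty_mem_powerset R)]
      · simp [setExp_empty]
      · intro R₁ hR₁ hne
        rw [mem_powerset] at hR₁
        split_ifs with hy
        · rw [zero_add] at hy
          rw [setExp_qwt_eq_sum_mul_qwt a y (nonempty_iff_ne_empty.mpr hne) (hrec_mono hR₁ hrec), hy]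
          ring
        · rfl
    rw [hsum]
    have h3 : ∀ u v w : ZMod 2, (u + 1) * v * (u * w) = 0 := by decide
    exact h3 _ _ _
  · -- (b)/(b′): the restriction `Σ_{R₁} y = 1` only removes the `R₁ = ∅` term
    subst hyT
    have hterm : ∀ R₁ ∈ R.powerset, (if 1 + ∑ i ∈ R₁, y i = 0 then
        (zT₁ + ∑ i ∈ R₁, z i) * (setExp (qwt a y) R₁ * setExp (qwt a y) (R \ R₁)) else 0) =
        (zT₁ + ∑ i ∈ R₁, z i) * (setExp (qwt a y) R₁ * setExp (qwt a y) (R \ R₁)) +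
          (if R₁ = ∅ then zT₁ * setExp (qwt a y) R else 0) := by
      intro R₁ hR₁
      rw [mem_powerset] at hR₁
      have h11 : (1 : ZMod 2) + 1 = 0 := by decide
      by_cases hne : R₁ = ∅
      · subst hne
        simp only [sum_empty, add_zero, if_true, setExp_empty, one_mul, sdiff_empty]
        rw [if_neg (show ¬((1 : ZMod 2) = 0) by decide)]
        exact (CharTwo.add_self_eq_zero _).symm
      · rw [if_neg hne, add_zero, setExp_qwt_eq_sum_mul_qwt a y (nonempty_iff_ne_empty.mpr hne) (hrec_mono hR₁ hrec)]
        obtain hy | hy : ∑ i ∈ R₁, y i = 0 ∨ ∑ i ∈ R₁, y i = 1 := by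
          generalize ∑ i ∈ R₁, y i = u; revert u; decide
        · rw [hy]; simp
        · rw [hy]; simp [h11]
    rw [sum_congr rfl hterm, sum_add_distrib, sum_ite_eq' R.powerset ∅, if_pos (empty_mem_powerset R)]
    have hsplit : ∑ R₁ ∈ R.powerset, (zT₁ + ∑ i ∈ R₁, z i) * (setExp (qwt a y) R₁ * setExp (qwt a y) (R \ R₁)) =
        zT₁ * (if R = ∅ then 1 else 0) + (∑ i ∈ R, z i) * qwt a y R := by
      rw [← hconv, ← hdoub, mul_sum, ← sum_add_distrib]
      exact sum_congr rfl fun R₁ _ => by ring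
    rw [hsplit]
    by_cases hR : R = ∅
    · subst hR
      rw [sum_empty, add_zero] at hz
      rw [if_pos rfl, sum_empty, zero_mul, add_zero, mul_one, setExp_empty, mul_one]
      have h3 : ∀ u v : ZMod 2, u + v = 1 → (u + 1) * v * (u + u) = 0 := by decide
      exact h3 _ _ hz
    · rw [if_neg hR, mul_zero, zero_add]
      have h3 : ∀ u v w d e : ZMod 2, u + v + w = 1 → (u + 1) * v * (w * d + u * e) = 0 := by decide
      exact h3 _ _ _ _ _ hz


omit [Fintype V] [LinearOrder V] in
/-- Sum over `{s} ∪ (A ∪ B)` for `s ∉ A ∪ B`, `A ∩ B = ∅`. [cite: Stanley1999EC2, Cor. 5.1.6 (exponential formula; elementary finite form)] -/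
theorem sum_insert_union [DecidableEq V] (f : V → ZMod 2) {s : V} {A B : Finset V} (hsA : s ∉ A) (hsB : s ∉ B)
    (hAB : Disjoint A B) : ∑ i ∈ insert s (A ∪ B), f i = ∑ i ∈ insert s A, f i + ∑ i ∈ B, f i := by
  rw [sum_insert (by rw [mem_union]; exact fun h => h.elim hsA hsB), sum_union hAB, sum_insert hsA, add_assoc]

/-- **THE KEY TWO-BLOCK LEMMA** (note §6 (KL)): let `W = {s, t} ⊔ W₀` carry the reciprocity law with `Σ_W y = 0` and `Σ_W z = 1`.
Then `Σ_{X ⊔ Y = W, s ∈ X, t ∈ Y, Σ_X y = 0, Σ_X z = 1} q_{z + e_s}(X) · q_z(Y) = 0`.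
Proof: both factors are pinned all-minors expansions (`pinned_expansion_eq`, valid since `Σ_X (z+e_s) = 0 = Σ_Y z` and both blocks are
even); regrouping the resulting fourfold sum by the two trees `T₁ ∋ s`, `T₂ ∋ t` (`sum_powerset_sum_powerset_sub`,
`sum_powerset_sum_powerset_sdiff_comm`) leaves, for each `(T₁, T₂)`, the `R₁`-sum of `stageA_eq_zero`, which vanishes.
This is the identity behind the `x_s x_t`-coefficients of (★). [cite: Smith2016CongruentDensity, §2.2 case 5(b)]
[cite: Chaiken1982, §2 (all minors matrix tree theorem)] -/
theorem key_two_block_sum_eq_zero (a : V → V → ZMod 2) (y z : V → ZMod 2) {W₀ : Finset V} {s t : V}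
    (hs : s ∉ W₀) (ht : t ∉ W₀) (hst : s ≠ t)
    (hrec : ∀ i ∈ insert s (insert t W₀), ∀ j ∈ insert s (insert t W₀), i ≠ j → a i j + a j i = y i * y j)
    (hyW : ∑ i ∈ insert s (insert t W₀), y i = 0) (hzW : ∑ i ∈ insert s (insert t W₀), z i = 1) :
    ∑ X₀ ∈ W₀.powerset.filter (fun X₀ => ∑ i ∈ insert s X₀, y i = 0 ∧ ∑ i ∈ insert s X₀, z i = 1),
      qwt a (fun i => z i + (Pi.single s (1 : ZMod 2) : V → ZMod 2) i) (insert s X₀) * qwt a z (insert t (W₀ \ X₀)) = 0 := by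
  set x : V → ZMod 2 := fun i => z i + (Pi.single s (1 : ZMod 2) : V → ZMod 2) i with hx
  set D : Finset V → ZMod 2 := setExp (qwt a y) with hD
  -- block weights of the two pinned expansions
  set α : Finset V → Finset V → ZMod 2 := fun E₁ R₁ => (∑ i ∈ insert s E₁, x i) * treeDet a (insert s E₁) s * D R₁ with hα
  set β : Finset V → Finset V → ZMod 2 := fun E₂ R₂ => (∑ i ∈ insert t E₂, z i) * treeDet a (insert t E₂) t * D R₂ with hβ
  set c : Finset V → ZMod 2 := fun X₀ => (if ∑ i ∈ insert s X₀, y i = 0 then 1 else 0) * ∑ i ∈ insert s X₀, z i with hc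
  have hstW : s ∉ insert t W₀ := by rw [mem_insert]; exact fun h => h.elim hst hs
  have hW : ∀ X₀ ⊆ W₀, insert s (insert t W₀) = insert s X₀ ∪ insert t (W₀ \ X₀) := by
    intro X₀ hX₀; ext i; simp only [mem_insert, mem_union, mem_sdiff]; constructor
    · rintro (h | h | h)
      · exact Or.inl (Or.inl h)
      · exact Or.inr (Or.inl h)
      · by_cases hi : i ∈ X₀
        · exact Or.inl (Or.inr hi)
        · exact Or.inr (Or.inr ⟨h, hi⟩)
    · rintro ((h | h) | h | ⟨h, _⟩)
      · exact Or.inl h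
      · exact Or.inr (Or.inr (hX₀ h))
      · exact Or.inr (Or.inl h)
      · exact Or.inr (Or.inr h)
  have hdisjXY : ∀ X₀ ⊆ W₀, Disjoint (insert s X₀) (insert t (W₀ \ X₀)) := by
    intro X₀ hX₀
    rw [disjoint_insert_left, disjoint_insert_right, mem_insert]
    refine ⟨fun h => h.elim hst (fun h => hs (mem_sdiff.mp h).1), fun h => ht (hX₀ h), disjoint_sdiff⟩
  -- Steps 1–2: pinned expansions under the filter, filter as the factor `c`
  have h12 : ∑ X₀ ∈ W₀.powerset.filter (fun X₀ => ∑ i ∈ insert s X₀, y i = 0 ∧ ∑ i ∈ insert s X₀, z i = 1),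
      qwt a x (insert s X₀) * qwt a z (insert t (W₀ \ X₀)) =
      ∑ X₀ ∈ W₀.powerset, c X₀ * ((∑ E₁ ∈ X₀.powerset, α E₁ (X₀ \ E₁)) *
        ∑ E₂ ∈ (W₀ \ X₀).powerset, β E₂ ((W₀ \ X₀) \ E₂)) := by
    rw [sum_filter]
    refine sum_congr rfl fun X₀ hX₀ => ?_
    rw [mem_powerset] at hX₀
    have hsX : s ∉ X₀ := fun h => hs (hX₀ h)
    have htY : t ∉ W₀ \ X₀ := fun h => ht (mem_sdiff.mp h).1
    have hXW : insert s X₀ ⊆ insert s (insert t W₀) := insert_subset_insert s (hX₀.trans (subset_insert t W₀))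
    have hYW : insert t (W₀ \ X₀) ⊆ insert s (insert t W₀) :=
      (insert_subset_insert t sdiff_subset).trans (subset_insert s _)
    by_cases hy : ∑ i ∈ insert s X₀, y i = 0
    · have hzY : ∑ i ∈ insert t (W₀ \ X₀), z i = 1 + ∑ i ∈ insert s X₀, z i := by
        have h := hzW; rw [hW X₀ hX₀, sum_union (hdisjXY X₀ hX₀)] at h
        have h2 : ∀ u v : ZMod 2, u + v = 1 → v = 1 + u := by decide
        exact h2 _ _ h
      have hyY : ∑ i ∈ insert t (W₀ \ X₀), y i = 0 := by
        have h := hyW; rw [hW X₀ hX₀, sum_union (hdisjXY X₀ hX₀), hy, zero_add] at h; exact h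
      by_cases hz1 : ∑ i ∈ insert s X₀, z i = 1
      · rw [if_pos ⟨hy, hz1⟩, hc]
        simp only [hy, hz1, if_true, one_mul]
        -- pinned expansion of the `s`-block
        have hPs := pinned_expansion_eq a y x (hrec_mono hXW hrec) hy (mem_insert_self s X₀)
        rw [erase_insert hsX] at hPs
        have hxX : ∑ i ∈ insert s X₀, x i = 0 := by
          rw [hx]; simp only [sum_add_distrib, sum_pi_single', mem_insert_self, if_true, hz1]; decide
        rw [hxX, zero_mul, add_zero] at hPs
        -- pinned expansion of the `t`-block
        have hPt := pinned_expansion_eq a y z (hrec_mono hYW hrec) hyY (mem_insert_self t (W₀ \ X₀))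
        rw [erase_insert htY, hzY, hz1] at hPt
        have h11 : (1 : ZMod 2) + 1 = 0 := by decide
        rw [h11, zero_mul, add_zero] at hPt
        rw [← hPs, ← hPt]
      · have h01 : ∀ u : ZMod 2, u ≠ 1 → u = 0 := by decide
        rw [if_neg (fun h => hz1 h.2), hc]
        simp only [hy, if_true, one_mul, h01 _ hz1, zero_mul]
    · rw [if_neg (fun h => hy h.1), hc]
      simp only [hy, if_false, zero_mul]
  rw [h12]
  -- Step 3: regroup by the tree `T₁ = {s} ∪ E₁` of the first block
  set PinT : Finset V → ZMod 2 := fun X₀ => ∑ E₂ ∈ (W₀ \ X₀).powerset, β E₂ ((W₀ \ X₀) \ E₂) with hPinT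
  have h3a : ∀ X₀ ∈ W₀.powerset, c X₀ * ((∑ E₁ ∈ X₀.powerset, α E₁ (X₀ \ E₁)) * PinT X₀) =
      ∑ E₁ ∈ X₀.powerset, c X₀ * α E₁ (X₀ \ E₁) * PinT X₀ := by
    intro X₀ _
    rw [sum_mul, mul_sum]
    exact sum_congr rfl fun E₁ _ => by ring
  rw [sum_congr rfl h3a, sum_powerset_sum_powerset_sub W₀ (fun E₁ X₀ => c X₀ * α E₁ (X₀ \ E₁) * PinT X₀)]
  refine sum_eq_zero fun E₁ hE₁ => ?_
  rw [mem_powerset] at hE₁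
  have hsE₁ : s ∉ E₁ := fun h => hs (hE₁ h)
  set T := W₀ \ E₁ with hT
  -- the inner double sum over `R₁ ⊆ T`, `E₂ ⊆ T ∖ R₁`, swapped
  have h3b : ∀ R₁ ∈ T.powerset, c (E₁ ∪ R₁) * α E₁ ((E₁ ∪ R₁) \ E₁) * PinT (E₁ ∪ R₁) =
      ∑ E₂ ∈ (T \ R₁).powerset, c (E₁ ∪ R₁) * α E₁ R₁ * β E₂ ((T \ E₂) \ R₁) := by
    intro R₁ hR₁
    rw [mem_powerset] at hR₁
    have hdis : Disjoint E₁ R₁ := disjoint_of_subset_right hR₁ disjoint_sdiff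
    have h1 : (E₁ ∪ R₁) \ E₁ = R₁ := union_sdiff_cancel_left hdis
    have h2 : W₀ \ (E₁ ∪ R₁) = T \ R₁ := by rw [hT, sdiff_sdiff_left, sup_eq_union]
    rw [h1, hPinT]
    simp only [h2]
    rw [mul_sum]
    exact sum_congr rfl fun E₂ _ => by rw [sdiff_right_comm]
  rw [sum_congr rfl h3b,
    sum_powerset_sum_powerset_sdiff_comm T (fun R₁ E₂ => c (E₁ ∪ R₁) * α E₁ R₁ * β E₂ ((T \ E₂) \ R₁))]
  refine sum_eq_zero fun E₂ hE₂ => ?_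
  rw [mem_powerset] at hE₂
  set R := T \ E₂ with hR
  -- Step 4: the `R₁`-sum is Stage A
  have hRW : R ⊆ insert s (insert t W₀) :=
    (sdiff_subset.trans (sdiff_subset)).trans ((subset_insert t W₀).trans (subset_insert s _))
  have htE₂ : t ∉ E₂ := fun h => ht ((hE₂.trans sdiff_subset) h)
  have htR : t ∉ R := fun h => ht ((sdiff_subset.trans sdiff_subset) h)
  have hE₂R : Disjoint E₂ R := disjoint_sdiff
  have hzsplit : ∑ i ∈ insert s E₁, z i + (∑ i ∈ insert t E₂, z i + ∑ i ∈ R, z i) = 1 := by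
    rw [← sum_insert_union z htE₂ htR hE₂R, union_comm, hR, sdiff_union_of_subset hE₂, hT,
      ← sum_union (hdisjXY E₁ hE₁), ← hW E₁ hE₁, hzW]
  have hterm : ∀ R₁ ∈ R.powerset, c (E₁ ∪ R₁) * α E₁ R₁ * β E₂ (R \ R₁) =
      ((∑ i ∈ insert s E₁, x i) * treeDet a (insert s E₁) s) * ((∑ i ∈ insert t E₂, z i) * treeDet a (insert t E₂) t) *
        (if ∑ i ∈ insert s E₁, y i + ∑ i ∈ R₁, y i = 0 then
          (∑ i ∈ insert s E₁, z i + ∑ i ∈ R₁, z i) * (D R₁ * D (R \ R₁)) else 0) := by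
    intro R₁ hR₁
    rw [mem_powerset] at hR₁
    have hsR₁ : s ∉ R₁ := fun h => hs ((hR₁.trans (sdiff_subset.trans sdiff_subset)) h)
    have hER : Disjoint E₁ R₁ := disjoint_of_subset_right (hR₁.trans sdiff_subset) disjoint_sdiff
    rw [hc, hα, hβ]
    simp only [sum_insert_union _ hsE₁ hsR₁ hER]
    split_ifs <;> ring
  rw [sum_congr rfl hterm, ← mul_sum]
  have hxT : ∑ i ∈ insert s E₁, x i = ∑ i ∈ insert s E₁, z i + 1 := by
    rw [hx]; simp only [sum_add_distrib, sum_pi_single', mem_insert_self, if_true]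
  rw [hxT]
  have hA := stageA_eq_zero a y z (hrec_mono hRW hrec) (∑ i ∈ insert s E₁, y i) (∑ i ∈ insert s E₁, z i)
    (∑ i ∈ insert t E₂, z i) (by rw [add_assoc]; exact hzsplit)
  rw [← hD] at hA
  calc (∑ i ∈ insert s E₁, z i + 1) * treeDet a (insert s E₁) s *
        ((∑ i ∈ insert t E₂, z i) * treeDet a (insert t E₂) t) *
        ∑ R₁ ∈ R.powerset, (if ∑ i ∈ insert s E₁, y i + ∑ i ∈ R₁, y i = 0 then
          (∑ i ∈ insert s E₁, z i + ∑ i ∈ R₁, z i) * (D R₁ * D (R \ R₁)) else 0)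
      = treeDet a (insert s E₁) s * treeDet a (insert t E₂) t *
        ((∑ i ∈ insert s E₁, z i + 1) * (∑ i ∈ insert t E₂, z i) *
        ∑ R₁ ∈ R.powerset, (if ∑ i ∈ insert s E₁, y i + ∑ i ∈ R₁, y i = 0 then
          (∑ i ∈ insert s E₁, z i + ∑ i ∈ R₁, z i) * (D R₁ * D (R \ R₁)) else 0)) := by ring
    _ = 0 := by rw [hA, mul_zero]



end Summit.BirchSwinnertonDyer.PrintCf2.QFormForest
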